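import Summits.BirchSwinnertonDyer.BirchSwinnertonDyer.Theorems.PrintCFramJZeroThreeUnitRegimePsi5K11
import Summits.BirchSwinnertonDyer.Rank1Residual.X12.O11.RouteUKroneckerReciprocity
import Mathlib.NumberTheory.LegendreSymbol.ZModChar
import Mathlib.Tactic.NormNum.LegendreSymbol
import HarnessLib

/-! # K12r@3 — the «3-unit regime» at `p = 3`: the KRONECKER-TYPE characters `χ₋₄` (conductor `4`,
# `d* = −1`), `χ₈` (conductor `8`, `d* = 2`), `χ₄₄ = χ₋₄↑·(·/11)↑` (conductor `44`, `d* = 11`) and the odd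
# Legendre character `(·/7)` (`d* = −7`) with values in `ℚ₃`: existence with an integer VALUE
# FUNCTION, primitivity, `ψ² = 1`, parity, `ψ(3) = −1` (Kriz–Li (1)) and the trace-form compatibility
# `v(ℓ) = J(d | ℓ)` at primes `ℓ ≡ 1 (mod 3)` for the Mordell classes they serve (cell `bsd-print-cfram`,
# seat p3 g2; regime N = `TorsionFreeFrameBSDThree`, stmt-BirchSwinnertonDyer-20698; P3-UNIT-REGIME-CENSUS §3)

HONEST FRAMING (cell `bsd-print-cfram`, run/shared/lean/pub/bsd-print-cfram/, D-0131 (2) print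
tier; verbatim in every file of the cell): the cell works the partition leaf
`CornerF ∧ p ramified in the CM field K` (LADDER-BSD row K7r = B13; W-ALL row 12r) in PARTITION
currency — a leaf or a cell counts only when its theorem is in the kernel BY NAME. Nothing here is a
Literature statement, no named fact is introduced, nothing is asserted about BSD; beyond-print: NO
(Dirichlet-character bookkeeping from Mathlib's `ZMod.χ₄`, `ZMod.χ₈`, `quadraticChar`; the `ℚ₃`
counterpart of bsd-cm's `RouteUKroneckerEven`/`RouteUKroneckerPsi` at `p = 7`, for the four characters
the K12r@3 unit regime needs). These are the `ψ`-inputs of `PrintCFram.bsdp_three_of_unitRegime_valuePsi`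
for the classes `432b, 3888p/s/t` (`χ₋₄`; Mordell `d ∈ {−1, 3}`), `576a, 1728a, 15552a/b/c` (`χ₈`;
`d = 2`), `17424bb/be/bf` (`χ₄₄`; `d = 11`), `1323m, 11907r/s/t` (`(·/7)`; `d ∈ {−7, 21}`).

* §1 `isPrimitive_of_apply_ne_one` — a character mod `n` all of whose proper-divisor levels divide
  `c` is primitive as soon as `χ(a) ≠ 1` at some `a ≡ 1 (mod c)` coprime to `n`.
* §2 `χ₋₄`: `exists_chiFour_three` (values `ZMod.χ₄`, with `χ² = 1`), primitive, ODD, `χ₄(3) = −1`;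
  `χ₄_eq_jacobiSym_neg_one` / `χ₄_eq_jacobiSym_three` (`J(−1 | ℓ) = χ₄(ℓ)`, odd `ℓ`; `J(3 | ℓ) = χ₄(ℓ)`,
  `ℓ ≡ 1 (mod 3)` odd).
* §3 `χ₈`: `exists_chiEight_three` (with `χ² = 1`), primitive, EVEN, `χ₈(3) = −1`; `J(2 | ℓ) = χ₈(ℓ)`.
* §4 `χ₄₄`: `exists_chiFortyFour_three` (values `χ₄(a)·J(a | 11)`), primitive, `χ² = 1`, EVEN,
  value `−1` at `3`; `J(11 | ℓ) = χ₄(ℓ)J(ℓ | 11)` (odd `ℓ`).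
* §5 `(·/7)`: ODD, `J(3 | 7) = −1`; `J(−7 | ℓ) = J(ℓ | 7)` and `J(21 | ℓ) = J(ℓ | 7)` (`ℓ ≡ 1 (3)` odd).
References: [KrizLi2019] Thm. 1.20 (pp. 7–8), §2 (pp. 11–12), §10.1; [Cox2013] §1.C Lemma 1.14,
(1.15)–(1.18); [MontgomeryVaughan2007] Thm. 9.13; [Washington1997] Ch. 3.
-/

set_option linter.dupNamespace false
set_option autoImplicit false

noncomputable section

open scoped Classical NumberTheorySymbols
open NumberField DirichletCharacter Literature.NumberTheory.EllipticCurves.KrizLi2019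
  Summit.BirchSwinnertonDyer.Rank1Residual.X12.O11.RouteU

namespace Summit.BirchSwinnertonDyer.BirchSwinnertonDyer.Theorems.PrintCFram

/-! ## §1 A primitivity criterion -/

/-- **Primitivity from one value.** If every proper divisor of the level `n` divides `c`, and
`χ(a) ≠ 1` for some `a ≡ 1 (mod c)` coprime to `n`, then `χ` is primitive (a character factoring
through a level `d ∣ c` is `1` at `a ≡ 1 (mod d)`). [cite: MontgomeryVaughan2007, Theorem 9.13]
[cite: Washington1997, Ch. 3 (conductor)] -/
theorem isPrimitive_of_apply_ne_one {R : Type*} [CommRing R] [IsDomain R] {n : ℕ} [NeZero n]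
    (χ : DirichletCharacter R n) {c : ℕ} (hc : ∀ d : ℕ, d ∣ n → d ≠ n → d ∣ c) {a : ℕ}
    (ha : a ≡ 1 [MOD c]) (hcop : a.Coprime n) (hχa : χ (a : ZMod n) ≠ 1) : χ.IsPrimitive := by
  by_contra hnp
  have hd : χ.conductor ∣ n := conductor_dvd_level χ
  have hne : χ.conductor ≠ n := fun h => hnp ((isPrimitive_def χ).mpr h)
  have hdc : χ.conductor ∣ c := hc _ hd hne
  obtain ⟨h', χ₀, hχ₀⟩ := factorsThrough_conductor χ
  have hcopZ : IsCoprime (a : ℤ) (n : ℤ) := Nat.isCoprime_iff_coprime.mpr hcop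
  have hval : χ (a : ZMod n) = χ₀ (a : ZMod χ.conductor) := by
    have := changeLevel_eq_cast_of_dvd' χ₀ h' hcopZ
    rw [← hχ₀, Int.cast_natCast, Int.cast_natCast] at this
    exact this
  have ha1 : (a : ZMod χ.conductor) = 1 := by
    have h1 : a ≡ 1 [MOD χ.conductor] := Nat.ModEq.of_dvd hdc ha
    rw [show (1 : ZMod χ.conductor) = ((1 : ℕ) : ZMod χ.conductor) by rw [Nat.cast_one]]
    exact (ZMod.natCast_eq_natCast_iff _ _ _).mpr h1
  exact hχa (by rw [hval, ha1, map_one])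

/-! ## §2 `χ₋₄` with values in `ℚ₃` -/

/-- **`χ₋₄` as a `ℚ₃`-valued Dirichlet character mod `4`** (Mathlib's `ZMod.χ₄` composed with
`ℤ → ℚ₃`): values `χ(a) = χ₄(a)`. [cite: Cox2013, §1.C (1.15)] -/
theorem exists_chiFour_three :
    ∃ χ : DirichletCharacter ℚ_[3] 4, χ * χ = 1 ∧
      ∀ a : ℕ, χ (a : ZMod 4) = ((ZMod.χ₄ (a : ZMod 4) : ℤ) : ℚ_[3]) := by
  refine ⟨ZMod.χ₄.ringHomComp (Int.castRingHom ℚ_[3]), MulChar.ext fun u => ?_,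
    fun a => by rw [MulChar.ringHomComp_apply]; rfl⟩
  have key : ∀ w : (ZMod 4)ˣ, (ZMod.χ₄ (w : ZMod 4) : ℤ) * ZMod.χ₄ (w : ZMod 4) = 1 := by decide
  rw [MulChar.mul_apply, MulChar.one_apply_coe, MulChar.ringHomComp_apply, ← map_mul, key u, map_one]

section ChiFour

variable (χ : DirichletCharacter ℚ_[3] 4) (hχ : ∀ a : ℕ, χ (a : ZMod 4) = ((ZMod.χ₄ (a : ZMod 4) : ℤ) : ℚ_[3]))
include hχ

/-- `χ₋₄(3) = −1` (Kriz–Li (1) at `p = 3`: `ψ(3) ≠ 1`). [cite: KrizLi2019, Thm. 1.20 (1) (p. 7)] -/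
theorem chiFour_apply_three : χ (3 : ZMod 4) = -1 := by
  rw [show (3 : ZMod 4) = ((3 : ℕ) : ZMod 4) by rfl, hχ]
  have : ZMod.χ₄ ((3 : ℕ) : ZMod 4) = -1 := by decide
  rw [this]; norm_num

/-- **`χ₋₄` is PRIMITIVE** (conductor `4`: `χ(3) = −1` with `3 ≡ 1 (mod 2)`). [cite: MontgomeryVaughan2007, Theorem 9.13] -/
theorem chiFour_isPrimitive : χ.IsPrimitive := by
  refine isPrimitive_of_apply_ne_one χ (c := 2) (fun d hd hne => ?_) (a := 3)
    (by decide) (by norm_num) (by rw [show ((3 : ℕ) : ZMod 4) = 3 by rfl, chiFour_apply_three χ hχ]; norm_num)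
  have h4 : d ≤ 4 := Nat.le_of_dvd (by norm_num) hd
  interval_cases d <;> simp_all

/-- **`χ₋₄` is ODD** (`χ(−1) = χ₄(3) = −1`). [cite: Cox2013, §1.C (1.15)] -/
theorem chiFour_odd : χ.Odd := by
  show χ (-1) = -1
  rw [show (-1 : ZMod 4) = 3 by decide]
  exact chiFour_apply_three χ hχ

end ChiFour

/-- **`J(−1 | ℓ) = χ₄(ℓ)`** for odd `ℓ` (the trace-form compatibility for `d = −1`: class `432b`).
[cite: Cox2013, §1.C (1.15)] -/
theorem chiFour_eq_jacobiSym_neg_one {ℓ : ℕ} (hℓ : Odd ℓ) : (ZMod.χ₄ (ℓ : ZMod 4) : ℤ) = J(-1 | ℓ) :=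
  (jacobiSym.at_neg_one hℓ).symm

/-- **`J(ℓ | 3) = 1` and `J(−3 | ℓ) = 1` for `ℓ ≡ 1 (mod 3)` odd** (`J(−3 | ℓ)·J(ℓ | 3) = J(9 | ℓ) = 1`).
[cite: Cox2013, §1.C Lemma 1.14 and (1.18)] -/
theorem jacobiSym_neg_three_of_mod_three_eq_one {ℓ : ℕ} (hℓ : Odd ℓ) (h1 : ℓ % 3 = 1) :
    J((ℓ : ℤ) | 3) = 1 ∧ J(-3 | ℓ) = 1 := by
  have hl3 : J((ℓ : ℤ) | 3) = 1 := by
    rw [jacobiSym.mod_left]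
    have : (ℓ : ℤ) % ((3 : ℕ) : ℤ) = 1 := by omega
    rw [this, jacobiSym.one_left]
  refine ⟨hl3, ?_⟩
  have h := jacobiSym_neg_mul_jacobiSym_eq (m := 3) (r := 3) (by norm_num) hℓ
  have hg : (3 : ℤ).gcd ℓ = 1 := by
    rw [Int.gcd_eq_natAbs, Int.natAbs_natCast]
    show Nat.gcd 3 ℓ = 1
    exact Nat.Coprime.gcd_eq_one ((Nat.Prime.coprime_iff_not_dvd Nat.prime_three).mpr (by omega))
  rw [hl3, mul_one, show (3 : ℤ) * (3 : ℕ) = 3 ^ 2 by norm_num, jacobiSym.sq_one' hg] at h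
  exact h

/-- **`J(3 | ℓ) = χ₄(ℓ)` for `ℓ ≡ 1 (mod 3)` odd** (the trace-form compatibility for `d = 3`: classes
`3888p/s/t`, `k = 12, 48, 3`; `J(3 | ℓ) = J(−1 | ℓ)·J(−3 | ℓ)`). [cite: Cox2013, §1.C Lemma 1.14 and (1.15)–(1.18)] -/
theorem chiFour_eq_jacobiSym_three {ℓ : ℕ} (hℓ : Odd ℓ) (h1 : ℓ % 3 = 1) :
    (ZMod.χ₄ (ℓ : ZMod 4) : ℤ) = J(3 | ℓ) := by
  rw [show (3 : ℤ) = -1 * -3 by norm_num, jacobiSym.mul_left, ← jacobiSym.at_neg_one hℓ,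
    (jacobiSym_neg_three_of_mod_three_eq_one hℓ h1).2, mul_one]

/-! ## §3 `χ₈` with values in `ℚ₃` -/

/-- **`χ₈` as a `ℚ₃`-valued Dirichlet character mod `8`** (Mathlib's `ZMod.χ₈`): values `χ(a) = χ₈(a)`.
[cite: Cox2013, §1.C (1.16)] -/
theorem exists_chiEight_three :
    ∃ χ : DirichletCharacter ℚ_[3] 8, χ * χ = 1 ∧
      ∀ a : ℕ, χ (a : ZMod 8) = ((ZMod.χ₈ (a : ZMod 8) : ℤ) : ℚ_[3]) := by
  refine ⟨ZMod.χ₈.ringHomComp (Int.castRingHom ℚ_[3]), MulChar.ext fun u => ?_,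
    fun a => by rw [MulChar.ringHomComp_apply]; rfl⟩
  have key : ∀ w : (ZMod 8)ˣ, (ZMod.χ₈ (w : ZMod 8) : ℤ) * ZMod.χ₈ (w : ZMod 8) = 1 := by decide
  rw [MulChar.mul_apply, MulChar.one_apply_coe, MulChar.ringHomComp_apply, ← map_mul, key u, map_one]

section ChiEight

variable (χ : DirichletCharacter ℚ_[3] 8) (hχ : ∀ a : ℕ, χ (a : ZMod 8) = ((ZMod.χ₈ (a : ZMod 8) : ℤ) : ℚ_[3]))
include hχ

/-- `χ₈(3) = −1` (Kriz–Li (1)). [cite: KrizLi2019, Thm. 1.20 (1) (p. 7)] -/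
theorem chiEight_apply_three : χ (3 : ZMod 8) = -1 := by
  rw [show (3 : ZMod 8) = ((3 : ℕ) : ZMod 8) by rfl, hχ]
  have : ZMod.χ₈ ((3 : ℕ) : ZMod 8) = -1 := by decide
  rw [this]; norm_num

/-- `χ₈(5) = −1`. [cite: Cox2013, §1.C (1.16)] -/
theorem chiEight_apply_five : χ (5 : ZMod 8) = -1 := by
  rw [show (5 : ZMod 8) = ((5 : ℕ) : ZMod 8) by rfl, hχ]
  have : ZMod.χ₈ ((5 : ℕ) : ZMod 8) = -1 := by decide
  rw [this]; norm_num

/-- **`χ₈` is PRIMITIVE** (conductor `8`: `χ(5) = −1` with `5 ≡ 1 (mod 4)`). [cite: MontgomeryVaughan2007, Theorem 9.13] -/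
theorem chiEight_isPrimitive : χ.IsPrimitive := by
  refine isPrimitive_of_apply_ne_one χ (c := 4) (fun d hd hne => ?_) (a := 5)
    (by decide) (by norm_num) (by rw [show ((5 : ℕ) : ZMod 8) = 5 by rfl, chiEight_apply_five χ hχ]; norm_num)
  have h8 : d ≤ 8 := Nat.le_of_dvd (by norm_num) hd
  interval_cases d <;> simp_all

/-- **`χ₈` is EVEN** (`χ(−1) = χ₈(7) = 1`). [cite: Cox2013, §1.C (1.16)] -/
theorem chiEight_even : χ.Even := by
  show χ (-1) = 1
  rw [show (-1 : ZMod 8) = ((7 : ℕ) : ZMod 8) by decide, hχ]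
  have : ZMod.χ₈ ((7 : ℕ) : ZMod 8) = 1 := by decide
  rw [this]; norm_num

end ChiEight

/-- **`J(2 | ℓ) = χ₈(ℓ)`** for odd `ℓ` (the trace-form compatibility for `d = 2`: classes `576a`,
`1728a`, `15552a/b/c`). [cite: Cox2013, §1.C (1.16)] -/
theorem chiEight_eq_jacobiSym_two {ℓ : ℕ} (hℓ : Odd ℓ) : (ZMod.χ₈ (ℓ : ZMod 8) : ℤ) = J(2 | ℓ) :=
  (jacobiSym.at_two hℓ).symm

/-! ## §4 `χ₄₄ = χ₋₄↑·(·/11)↑` with values in `ℚ₃` -/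

/-- **`χ₄₄` as a `ℚ₃`-valued Dirichlet character mod `44 = 4·11`** with values
`χ(a) = χ₄(a)·J(a | 11)` (the character of `ℚ(√11)`, discriminant `44`). [cite: Cox2013, §1.C Lemma 1.14 and (1.15)–(1.18)] -/
theorem exists_chiFortyFour_three :
    ∃ χ : DirichletCharacter ℚ_[3] (4 * 11), χ.IsPrimitive ∧ χ * χ = 1 ∧
      ∀ a : ℕ, χ (a : ZMod (4 * 11)) = ((ZMod.χ₄ (a : ZMod 4) * J((a : ℤ) | 11) : ℤ) : ℚ_[3]) := by
  haveI : Fact (Nat.Prime 11) := ⟨by norm_num⟩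
  obtain ⟨χ4, h4sq, h4⟩ := exists_chiFour_three
  obtain ⟨χ11, h11⟩ := exists_legendreCharacter_three 11
  refine ⟨changeLevel (dvd_mul_right 4 11) χ4 * changeLevel (dvd_mul_left 11 4) χ11, ?_, ?_, fun a => ?_⟩
  · have hc4 : χ4.conductor = 4 := chiFour_isPrimitive χ4 h4
    have hc11 : χ11.conductor = 11 :=
      conductor_eq_of_prime_of_ne_one χ11 (legendreChar_three_ne_one χ11 h11 (by norm_num))
    rw [isPrimitive_def, conductor_changeLevel_mul_changeLevel _ _ χ4 χ11 (by rw [hc4, hc11]; norm_num),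
      hc4, hc11]
  · rw [mul_mul_mul_comm, ← map_mul, ← map_mul, h4sq,
      legendreChar_three_mul_self χ11 h11, map_one, map_one, mul_one]
  · by_cases hu : IsCoprime (a : ℤ) ((4 * 11 : ℕ) : ℤ)
    · rw [show ((a : ℕ) : ZMod (4 * 11)) = ((a : ℤ) : ZMod (4 * 11)) by rw [Int.cast_natCast],
        MulChar.mul_apply, changeLevel_eq_cast_of_dvd' _ _ hu, changeLevel_eq_cast_of_dvd' _ _ hu,
        Int.cast_natCast, Int.cast_natCast, h4, h11, jacobiSym.legendreSym.to_jacobiSym, Int.cast_mul]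
    · have hnu : ¬ IsUnit ((a : ℕ) : ZMod (4 * 11)) := by
        rw [ZMod.isUnit_iff_coprime]; exact fun h => hu (Nat.isCoprime_iff_coprime.mpr h)
      rw [MulChar.map_nonunit _ hnu]
      have hc : ¬ a.Coprime (4 * 11) := fun h => hu (Nat.isCoprime_iff_coprime.mpr h)
      rw [Nat.coprime_mul_iff_right, not_and_or] at hc
      rcases hc with h1 | h1
      · have h2 : ¬ a.Coprime 2 := fun h => h1 (by
          rw [show (4 : ℕ) = 2 ^ 2 by norm_num]; exact Nat.Coprime.pow_right 2 h)
        have hev : a % 2 = 0 := by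
          rw [Nat.coprime_comm, Nat.Prime.coprime_iff_not_dvd Nat.prime_two, not_not] at h2; omega
        rw [ZMod.χ₄_nat_eq_if_mod_four, if_pos hev]; simp
      · have hd : 11 ∣ a := by
          rwa [Nat.coprime_comm, Nat.Prime.coprime_iff_not_dvd (by norm_num), not_not] at h1
        rw [← jacobiSym.legendreSym.to_jacobiSym, (legendreSym.eq_zero_iff 11 (a : ℤ)).mpr (by
          rw [Int.cast_natCast]; exact (ZMod.natCast_eq_zero_iff _ _).mpr hd)]
        simp

/-- `χ₄₄` at `3`: `χ₄(3)·J(3 | 11) = −1` (Kriz–Li (1)). [cite: KrizLi2019, Thm. 1.20 (1) (p. 7)] -/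
theorem chiFortyFour_val_three : (ZMod.χ₄ ((3 : ℕ) : ZMod 4) * J(((3 : ℕ) : ℤ) | 11) : ℤ) = -1 := by
  have h1 : ZMod.χ₄ ((3 : ℕ) : ZMod 4) = -1 := by decide
  rw [h1]; norm_num

/-- **`χ₄₄` is EVEN**: `χ(−1) = χ₄(43)·J(43 | 11) = (−1)(−1) = 1`. [cite: Cox2013, §1.C Lemma 1.14] -/
theorem chiFortyFour_even (χ : DirichletCharacter ℚ_[3] (4 * 11))
    (hχ : ∀ a : ℕ, χ (a : ZMod (4 * 11)) = ((ZMod.χ₄ (a : ZMod 4) * J((a : ℤ) | 11) : ℤ) : ℚ_[3])) :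
    χ.Even := by
  show χ (-1) = 1
  rw [show (-1 : ZMod (4 * 11)) = ((43 : ℕ) : ZMod (4 * 11)) by decide, hχ]
  have h1 : ZMod.χ₄ ((43 : ℕ) : ZMod 4) = -1 := by decide
  rw [h1]; norm_num

/-- **`J(11 | ℓ) = χ₄(ℓ)·J(ℓ | 11)`** for odd `ℓ` (the trace-form compatibility for `d = 11`: classes
`17424bb/be/bf`; reciprocity for `11 ≡ 3 (mod 4)`). [cite: Cox2013, §1.C Lemma 1.14 and (1.15)–(1.18)] -/
theorem chiFortyFour_eq_jacobiSym_eleven {ℓ : ℕ} (hℓ : Odd ℓ) :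
    (ZMod.χ₄ (ℓ : ZMod 4) * J((ℓ : ℤ) | 11) : ℤ) = J(11 | ℓ) := by
  rw [← jacobiSym.at_neg_one hℓ]
  have := jacobiSym_neg_mul_jacobiSym_eq (m := 1) (r := 11) (by norm_num) hℓ
  simpa using this

/-! ## §5 The odd Legendre character `(·/7)` -/

/-- `J(3 | 7) = −1` (Kriz–Li (1) for `ψ = (·/7)`) and `J(−1 | 7) = −1` (`(·/7)` is ODD).
[cite: KrizLi2019, Thm. 1.20 (1) (p. 7)] -/
theorem jacobiSym_seven_values : J(3 | 7) = -1 ∧ J(-1 | 7) = -1 := by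
  constructor <;> norm_num

/-- **The `ℚ₃`-valued Legendre character mod `7` is ODD.** [cite: Cox2013, §1.C (1.17)] -/
theorem legendreChar_seven_odd (χ : DirichletCharacter ℚ_[3] 7)
    (hχ : ∀ a : ℕ, χ (a : ZMod 7) = (legendreSym 7 (a : ℤ) : ℚ_[3])) : χ.Odd := by
  show χ (-1) = -1
  rw [show (-1 : ZMod 7) = ((6 : ℕ) : ZMod 7) by decide, hχ, jacobiSym.legendreSym.to_jacobiSym]
  have : J(((6 : ℕ) : ℤ) | 7) = -1 := by norm_num
  rw [this]; norm_num

/-- **`J(−7 | ℓ) = J(ℓ | 7)` and `J(21 | ℓ) = J(ℓ | 7)` for `ℓ ≡ 1 (mod 3)` odd, `ℓ ≠ 7`** (the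
trace-form compatibility for `d = −7`: class `1323m`, and `d = 21`: classes `11907r/s/t`;
`J(−7|ℓ)J(ℓ|7) = J(49|ℓ) = 1`, `J(21|ℓ) = J(−7|ℓ)J(−3|ℓ)`). [cite: Cox2013, §1.C Lemma 1.14 and (1.15)–(1.18)] -/
theorem jacobiSym_seven_compat {ℓ : ℕ} (hℓ : Odd ℓ) (h1 : ℓ % 3 = 1) (h7 : ℓ.Coprime 7) :
    J((ℓ : ℤ) | 7) = J(-7 | ℓ) ∧ J((ℓ : ℤ) | 7) = J(21 | ℓ) := by
  have h := jacobiSym_neg_mul_jacobiSym_eq (m := 7) (r := 7) (by norm_num) hℓ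
  have hg : (7 : ℤ).gcd ℓ = 1 := by
    rw [Int.gcd_eq_natAbs, Int.natAbs_natCast]
    show Nat.gcd 7 ℓ = 1
    exact Nat.Coprime.gcd_eq_one h7.symm
  rw [show (7 : ℤ) * (7 : ℕ) = 7 ^ 2 by norm_num, jacobiSym.sq_one' hg] at h
  -- `J(−7|ℓ)·J(ℓ|7) = 1` with both factors `±1`
  have hpm : J((ℓ : ℤ) | 7) = 1 ∨ J((ℓ : ℤ) | 7) = -1 :=
    jacobiSym.eq_one_or_neg_one (by rw [Int.gcd_natCast_natCast]; exact h7.gcd_eq_one)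
  have hneg7 : J(-7 | ℓ) = J((ℓ : ℤ) | 7) := by
    rcases hpm with hp | hp <;> rw [hp] at h ⊢ <;> linarith
  refine ⟨hneg7.symm, ?_⟩
  rw [show (21 : ℤ) = -7 * -3 by norm_num, jacobiSym.mul_left,
    (jacobiSym_neg_three_of_mod_three_eq_one hℓ h1).2, mul_one, hneg7]

end Summit.BirchSwinnertonDyer.BirchSwinnertonDyer.Theorems.PrintCFram

end
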